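import Summits.BirchSwinnertonDyer.BirchSwinnertonDyer.Theorems.ManinLocalTwoThreeKummerDiamondStepTwoOddClass
import Summits.BirchSwinnertonDyer.BirchSwinnertonDyer.Theorems.ManinLocalTwoThreeCDivisionIndexFourRationalTwoTorsion
import HarnessLib

/-!
# The residual inputs (T2) and (O) of PROPOSITION A WITHOUT F★ / CES
(route `ManinLocalTwoThree`, crux C2 `ManinOddAtFour` stmt-BirchSwinnertonDyer-22967; cell bsd-f2-manin, prover p3 gen 19; inputs `hfix2` and `S₁` of
`StepTwo.propositionA_of_reciprocity` in the line of record `kummer_diamond`)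

p2's `StepTwo.twoTorsion_fixed_of_index_four` (T2) and `StepTwo.exists_odd_quarterPoint_of_index_four` (O) consume the printed facts F★
(`optimalGamma1Parametrization_cusp_rational`) and CES (`exists_optimal_gamma1ParametrizationData`) ONLY through E-an-152d (the three rational
`2`-torsion abscissae, p757495).  Here the same conclusions are derived
* from the three rational `2`-torsion abscissae as a HYPOTHESIS (`twoTorsion_fixed_of_three_hasRationalTwoTorsionX`,
  `exists_odd_quarterPoint_of_three_hasRationalTwoTorsionX` — no index-`4`, no printed fact), and
* in the index-`4` world with `|c₀| = 2` from the KERNEL theorem `CDivTranslate.exists_three_hasRationalTwoTorsionX_of_indexFour` (p762291):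
  `twoTorsion_fixed_of_indexFour_of_natAbs_two`, `exists_odd_quarterPoint_of_indexFour_of_natAbs_two` — NO F★, NO CES.
In the C2 composition `|c₀| = 2` is available (CDT: `c₀ ∣ 2`; negated goal `2 ∣ c₀`), so the E-es-185 port needs F★ nowhere and CES only inside the reciprocity
itself.  Nothing about E-es-185, C2, Manin's conjecture or BSD is proved.  No definitions, no sorry. [cite: SilvermanAEC2009, Prop. X.1.4] [cite: Stevens1989, §2]
-/

set_option autoImplicit false
-- lint-debt: the directory name repeats the summit name (sibling precedent `ManinLocalTwoThreeKummerDiamondStepTwoOddClass.lean`)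
set_option linter.dupNamespace false

noncomputable section

open scoped MatrixGroups ComplexConjugate
open CongruenceSubgroup WeierstrassCurve Literature.NumberTheory.EllipticCurves Literature.NumberTheory.EllipticCurves.ModularForms
open Literature.NumberTheory.EllipticCurves.Greenberg1999

namespace Summit.BirchSwinnertonDyer.BirchSwinnertonDyer.Theorems.ManinLocalTwoThree.StepTwo

variable {W₀ : WeierstrassCurve ℚ} [W₀.IsElliptic] {N : ℕ} [NeZero N]

/-- **(T2) from three rational `2`-torsion abscissae**: if `W₀` has three distinct rational `2`-torsion abscissae then every point of `W₀(ℂ)` killed by `2` is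
fixed by `Aut(ℂ/ℚ)` (the four points `O, T₁, T₂, T₃` are rational and `|W₀(ℂ)[2]| ≤ 4`, `ncard_twoTorsion_le_four`).  No index hypothesis, no printed fact.
[cite: SilvermanAEC2009, Prop. X.1.4] -/
theorem twoTorsion_fixed_of_three_hasRationalTwoTorsionX (D₀ : ModularParametrizationData W₀ N)
    (h3 : ∃ x₁ x₂ x₃ : ℚ, x₁ ≠ x₂ ∧ x₁ ≠ x₃ ∧ x₂ ≠ x₃ ∧
      HasRationalTwoTorsionX W₀ x₁ ∧ HasRationalTwoTorsionX W₀ x₂ ∧ HasRationalTwoTorsionX W₀ x₃)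
    (S : (W₀.baseChange ℂ).toAffine.Point) (hS : 2 • S = 0) (σ : ℂ ≃ₐ[ℚ] ℂ) :
    Affine.Point.map (W' := W₀) (σ : ℂ →ₐ[ℚ] ℂ) S = S := by
  obtain ⟨x₁, x₂, x₃, h12, h13, h23, ⟨y₁, he₁, ht₁⟩, ⟨y₂, he₂, ht₂⟩, ⟨y₃, he₃, ht₃⟩⟩ := h3
  have hn₁ := nonsingular_baseChange_of_equation he₁
  have hn₂ := nonsingular_baseChange_of_equation he₂
  have hn₃ := nonsingular_baseChange_of_equation he₃
  set T₁ := Affine.Point.some _ _ hn₁ with hT₁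
  set T₂ := Affine.Point.some _ _ hn₂ with hT₂
  set T₃ := Affine.Point.some _ _ hn₃ with hT₃
  -- the four-set `{0, T₁, T₂, T₃}` is all of `W₀(ℂ)[2]`
  have hne : ∀ {a b c d : ℚ} (ha : (W₀.baseChange ℂ).toAffine.Nonsingular (a : ℂ) (b : ℂ))
      (hc : (W₀.baseChange ℂ).toAffine.Nonsingular (c : ℂ) (d : ℂ)), a ≠ c → Affine.Point.some _ _ ha ≠ Affine.Point.some _ _ hc := by
    intro a b c d ha hc hac h
    rw [Affine.Point.some.injEq] at h
    exact hac (by exact_mod_cast h.1)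
  have hsub : ({0, T₁, T₂, T₃} : Set (W₀.baseChange ℂ).toAffine.Point) ⊆ {S | 2 • S = 0} := by
    intro P hP
    simp only [Set.mem_insert_iff, Set.mem_singleton_iff] at hP
    rcases hP with rfl | rfl | rfl | rfl
    · exact (nsmul_zero 2 : (2 : ℕ) • (0 : (W₀.baseChange ℂ).toAffine.Point) = 0)
    · exact two_nsmul_some_eq_zero hn₁ ht₁
    · exact two_nsmul_some_eq_zero hn₂ ht₂
    · exact two_nsmul_some_eq_zero hn₃ ht₃
  have hcard : ({0, T₁, T₂, T₃} : Set (W₀.baseChange ℂ).toAffine.Point).ncard = 4 := by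
    rw [Set.ncard_insert_of_notMem (by
          simp only [Set.mem_insert_iff, Set.mem_singleton_iff, not_or]
          exact ⟨(Affine.Point.some_ne_zero hn₁).symm, (Affine.Point.some_ne_zero hn₂).symm, (Affine.Point.some_ne_zero hn₃).symm⟩),
      Set.ncard_insert_of_notMem (by
          simp only [Set.mem_insert_iff, Set.mem_singleton_iff, not_or]
          exact ⟨hne hn₁ hn₂ h12, hne hn₁ hn₃ h13⟩),
      Set.ncard_pair (hne hn₂ hn₃ h23)]
  obtain ⟨hfin, hle⟩ := ncard_twoTorsion_le_four D₀
  have heq : ({0, T₁, T₂, T₃} : Set (W₀.baseChange ℂ).toAffine.Point) = {S | 2 • S = 0} :=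
    Set.eq_of_subset_of_ncard_le hsub (by rw [hcard]; exact hle) hfin
  have hS' : S ∈ ({0, T₁, T₂, T₃} : Set (W₀.baseChange ℂ).toAffine.Point) := by rw [heq]; exact hS
  simp only [Set.mem_insert_iff, Set.mem_singleton_iff] at hS'
  rcases hS' with rfl | rfl | rfl | rfl
  · exact map_zero _
  · exact map_some_ratCast hn₁ σ
  · exact map_some_ratCast hn₂ σ
  · exact map_some_ratCast hn₃ σ

/-- **(T2) in the index-`4` world with `|c₀| = 2`, NO F★ / CES**: every `2`-torsion point of `W₀(ℂ)` is fixed by `Aut(ℂ/ℚ)` — the three rational abscissae come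
from the kernel theorem `CDivTranslate.exists_three_hasRationalTwoTorsionX_of_indexFour`. [cite: SilvermanAEC2009, Prop. X.1.4] [cite: ShimuraIATAF1971, Thm. 3.52] -/
theorem twoTorsion_fixed_of_indexFour_of_natAbs_two [W₀.IsGloballyMinimal] (D₀ : ModularParametrizationData W₀ N)
    (hopt : ∀ z ∈ D₀.L.lattice, ∃ w ∈ periodLattice D₀.f, z = D₀.c * w) (hc2 : D₀.c.natAbs = 2)
    (h4 : ∀ z : ℂ, z ∈ periodLatticeGamma1 D₀.f ↔ ∃ w ∈ periodLattice D₀.f, z = 2 * w)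
    (S : (W₀.baseChange ℂ).toAffine.Point) (hS : 2 • S = 0) (σ : ℂ ≃ₐ[ℚ] ℂ) :
    Affine.Point.map (W' := W₀) (σ : ℂ →ₐ[ℚ] ℂ) S = S :=
  twoTorsion_fixed_of_three_hasRationalTwoTorsionX D₀ (CDivTranslate.exists_three_hasRationalTwoTorsionX_of_indexFour D₀ hopt hc2 h4) S hS σ

/-- **(O) from three rational `2`-torsion abscissae**: there is `S₁ = π₀(ω/4)` with `2·(2S₁) = 0`, `2S₁` of finite order and fixed by `Aut(ℂ/ℚ)`, and
`conj S₁ ≠ S₁` — for ANY datum whose curve has three distinct rational `2`-torsion abscissae (p2's lattice argument `not_both_half_im_mem` verbatim; (T2) from the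
previous theorem).  No index hypothesis, no printed fact. [cite: SilvermanAEC2009, Prop. X.1.4] -/
theorem exists_odd_quarterPoint_of_three_hasRationalTwoTorsionX (D₀ : ModularParametrizationData W₀ N)
    (h3 : ∃ x₁ x₂ x₃ : ℚ, x₁ ≠ x₂ ∧ x₁ ≠ x₃ ∧ x₂ ≠ x₃ ∧
      HasRationalTwoTorsionX W₀ x₁ ∧ HasRationalTwoTorsionX W₀ x₂ ∧ HasRationalTwoTorsionX W₀ x₃) :
    ∃ S₁ : (W₀.baseChange ℂ).toAffine.Point, 2 • (2 • S₁) = 0 ∧ IsOfFinAddOrder (2 • S₁) ∧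
      (∀ σ : ℂ ≃ₐ[ℚ] ℂ, Affine.Point.map (W' := W₀) (σ : ℂ →ₐ[ℚ] ℂ) (2 • S₁) = 2 • S₁) ∧
      Affine.Point.map (W' := W₀) ((Complex.conjAe.restrictScalars ℚ : ℂ ≃ₐ[ℚ] ℂ) : ℂ →ₐ[ℚ] ℂ) S₁ ≠ S₁ := by
  -- a basis vector `ω` with `i·im(ω)/2 ∉ Λ`
  obtain ⟨ω, hω, hη⟩ : ∃ ω ∈ D₀.L.lattice, (ω.im : ℂ) * Complex.I / 2 ∉ D₀.L.lattice := by
    by_cases h₁ : (D₀.L.ω₁.im : ℂ) * Complex.I / 2 ∈ D₀.L.lattice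
    · exact ⟨D₀.L.ω₂, D₀.L.ω₂_mem_lattice, fun h₂ ↦ not_both_half_im_mem D₀.L ⟨h₁, h₂⟩⟩
    · exact ⟨D₀.L.ω₁, D₀.L.ω₁_mem_lattice, h₁⟩
  refine ⟨D₀.uniformize (ω / 4), ?_, ?_, ?_, ?_⟩
  · rw [← map_nsmul, ← map_nsmul, D₀.uniformize_eq_zero_iff]
    convert hω using 1
    simp only [nsmul_eq_mul]; push_cast; ring
  · refine isOfFinAddOrder_iff_nsmul_eq_zero.mpr ⟨2, two_pos, ?_⟩
    rw [← map_nsmul, ← map_nsmul, D₀.uniformize_eq_zero_iff]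
    convert hω using 1
    simp only [nsmul_eq_mul]; push_cast; ring
  · intro σ
    refine twoTorsion_fixed_of_three_hasRationalTwoTorsionX D₀ h3 _ ?_ σ
    rw [← map_nsmul, ← map_nsmul, D₀.uniformize_eq_zero_iff]
    convert hω using 1
    simp only [nsmul_eq_mul]; push_cast; ring
  · rw [map_conj_uniformize, Ne, uniformize_eq_uniformize_iff]
    intro hmem
    apply hη
    have e : conj (ω / 4) - ω / 4 = -((ω.im : ℂ) * Complex.I / 2) := by
      have h := Complex.sub_conj (ω / 4)
      rw [Complex.div_ofNat_im] at h
      have h' : conj (ω / 4) - ω / 4 = -(((2 * (ω.im / 4) : ℝ) : ℂ) * Complex.I) := by rw [← h]; ring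
      rw [h']; push_cast; ring
    rw [e, neg_mem_iff] at hmem
    exact hmem

/-- **(O) in the index-`4` world with `|c₀| = 2`, NO F★ / CES.** [cite: SilvermanAEC2009, Prop. X.1.4] [cite: ShimuraIATAF1971, Thm. 3.52] -/
theorem exists_odd_quarterPoint_of_indexFour_of_natAbs_two [W₀.IsGloballyMinimal] (D₀ : ModularParametrizationData W₀ N)
    (hopt : ∀ z ∈ D₀.L.lattice, ∃ w ∈ periodLattice D₀.f, z = D₀.c * w) (hc2 : D₀.c.natAbs = 2)
    (h4 : ∀ z : ℂ, z ∈ periodLatticeGamma1 D₀.f ↔ ∃ w ∈ periodLattice D₀.f, z = 2 * w) :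
    ∃ S₁ : (W₀.baseChange ℂ).toAffine.Point, 2 • (2 • S₁) = 0 ∧ IsOfFinAddOrder (2 • S₁) ∧
      (∀ σ : ℂ ≃ₐ[ℚ] ℂ, Affine.Point.map (W' := W₀) (σ : ℂ →ₐ[ℚ] ℂ) (2 • S₁) = 2 • S₁) ∧
      Affine.Point.map (W' := W₀) ((Complex.conjAe.restrictScalars ℚ : ℂ ≃ₐ[ℚ] ℂ) : ℂ →ₐ[ℚ] ℂ) S₁ ≠ S₁ :=
  exists_odd_quarterPoint_of_three_hasRationalTwoTorsionX D₀ (CDivTranslate.exists_three_hasRationalTwoTorsionX_of_indexFour D₀ hopt hc2 h4)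

end Summit.BirchSwinnertonDyer.BirchSwinnertonDyer.Theorems.ManinLocalTwoThree.StepTwo

end
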